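import Summits.SmoothPoincare4.SmoothPoincare4.Theorems.CongruenceShadowsNormalFormStablyTrivialLuftDefs

/-!
# Stub `stub_movesGoeritz` of line `luft-twist-reduction` for crux `NormalFormStablyTrivial`
# (item stmt-SmoothPoincare4-14591, route `CongruenceShadows`) — auxiliary file 1: the framework

The stub `MovesGoeritz` (`…LuftDefs.lean` §4) asks that every padding move of
`F_{3+3m} = S ⧸ N₁` (right transvection `xᵢ ↦ xᵢ x_t` BY a trivial letter, partial conjugation
`x_t ↦ x_j⁻¹ x_t x_j` OF a trivial letter, `t ≢ 0 (mod 3)`) be induced through `eraseN1` by an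
automorphism of `S = S_{3+3m}` stabilising both standard kernels `N m 0`, `N m 1` (an element of
the Goeritz group of the standard genus-`3(m+1)` Heegaard splitting of `#^{m+1} S¹×S²`).  This
file is the bookkeeping; the realisers (explicit two-handle automorphisms of `S_g`: the drags of a
knob around a handle, the handle slides corrected by a meridian transvection) are the sibling files
`…LuftStubMovesGoeritzAux2.lean` – `…Aux5.lean`, and the stub is assembled in
`…LuftStubMovesGoeritz.lean`.

* §1 THE `a`-NORMALISATION.  All realisers are written for the cut system `{aᵢ}`
  (`A = SurfaceGroup.aKernel g`, erasure `eraseA : aᵢ ↦ 1, bᵢ ↦ xᵢ`) together with a second cut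
  system `cutKernel d` (`d i = true`: cut `bᵢ`, a TRIVIAL handle — its two meridians meet once;
  `d i = false`: cut `aᵢ` again, an ESSENTIAL handle — an `S¹×S²` summand).
  `map_aKernel_eq_of_eraseA`: an automorphism inducing anything through `eraseA` stabilises `A`;
  `map_cutKernel_eq_of_block`, `eraseA_apply_eq_of_block`: for an automorphism moving only the
  handles `k`, `l`, stabilising `cutKernel d` and inducing `θ` are checked on the four letters
  `a_k, b_k, a_l, b_l` (erasure test `SurfaceGroup.map_cutKernel_eq_of`, `PresentedGroup.ext`).
* §2 TRANSPORT (registered helper `helper_movesGoeritz_1`).  The cut swap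
  `C = cutSwapEquiv (cPat m 1)` carries `A` onto `N m 1` (`map_aKernel_cutSwapEquiv`) and
  `cutKernel (i ↦ i % 3 ≠ 0)` onto `N m 0` (`map_cutKernel_cutSwapEquiv` and the pattern identity
  `cPat_zero_eq`); hence `y ↦ C ∘ y ∘ C⁻¹` turns a realiser of `θ` in the `a`-normalisation into a
  witness of `θ ∈ goeritzInduced m` (`eraseN1 = eraseA ∘ C⁻¹`).

References: Zieschang–Vogt–Coldewey, LNM 835 (1980) §3.2, §3.6; Griffiths, Abh. Math. Sem. Univ.
Hamburg 26 (1964); Luft, Math. Ann. 234 (1978).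
-/

-- the prescribed namespace `Summit.<P>.<Sub>.…` duplicates `SmoothPoincare4` (P = Sub)
set_option linter.dupNamespace false

noncomputable section

namespace Summit.SmoothPoincare4.SmoothPoincare4.Theorems.NormalFormStablyTrivial.Luft

open Literature.Topology.FourManifolds Subgroup

variable {g : ℕ}

/-! ## §1 The `a`-normalisation: kernel and induced-map criteria -/

/-- An automorphism of `S_g` inducing an automorphism of `F_g` through `eraseA` stabilises
`⟪aᵢ⟫ = ker eraseA`. [folklore] -/
theorem map_aKernel_eq_of_eraseA (y : SurfaceGroup g ≃* SurfaceGroup g)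
    (θ : MulAut (FreeGroup (Fin g))) (h : ∀ s, SurfaceGroup.eraseA (y s) = θ (SurfaceGroup.eraseA s)) :
    (SurfaceGroup.aKernel g).map y.toMonoidHom = SurfaceGroup.aKernel g := by
  ext s
  simp only [Subgroup.mem_map, MulEquiv.coe_toMonoidHom, SurfaceGroup.mem_aKernel_iff]
  constructor
  · rintro ⟨t, ht, rfl⟩
    rw [h, ht, map_one]
  · intro hs
    refine ⟨y.symm s, ?_, y.apply_symm_apply s⟩
    have h1 := h (y.symm s)
    rw [MulEquiv.apply_symm_apply, hs] at h1
    exact θ.injective (by rw [← h1, map_one])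

/-- `eraseA` kills the middle block `mid k l`. [folklore] -/
theorem eraseA_mid (k l : ℕ) : SurfaceGroup.eraseA (SurfaceGroup.mid k l : SurfaceGroup g) = 1 :=
  SurfaceGroup.map_mid_eq_one _ k l fun j => Or.inl (SurfaceGroup.eraseA_a j)

/-- An automorphism fixing a generator has inverse fixing it. [folklore] -/
theorem symm_apply_of_eq (y : SurfaceGroup g ≃* SurfaceGroup g) {p : surfaceGen g}
    (h : y (PresentedGroup.of p) = PresentedGroup.of p) :
    y.symm (PresentedGroup.of p) = PresentedGroup.of p :=
  y.injective (by rw [MulEquiv.apply_symm_apply, h])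

/-- **Two-handle erasure test.**  An automorphism `y` of `S_g` fixing the generators of all handles
other than `k`, `l` stabilises `cutKernel d` as soon as the images AND inverse images of the two
cut letters of the handles `k`, `l` pass the erasure test of `d`. [folklore] -/
theorem map_cutKernel_eq_of_block (y : SurfaceGroup g ≃* SurfaceGroup g) (d : Fin g → Bool)
    (k l : Fin g)
    (hfix : ∀ i, i ≠ k → i ≠ l → ∀ s, y (PresentedGroup.of (i, s)) = PresentedGroup.of (i, s))
    (hk : SurfaceGroup.eraseA ((SurfaceGroup.cutSwapEquiv d).symm
      (y (PresentedGroup.of (k, d k)))) = 1)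
    (hl : SurfaceGroup.eraseA ((SurfaceGroup.cutSwapEquiv d).symm
      (y (PresentedGroup.of (l, d l)))) = 1)
    (hk' : SurfaceGroup.eraseA ((SurfaceGroup.cutSwapEquiv d).symm
      (y.symm (PresentedGroup.of (k, d k)))) = 1)
    (hl' : SurfaceGroup.eraseA ((SurfaceGroup.cutSwapEquiv d).symm
      (y.symm (PresentedGroup.of (l, d l)))) = 1) :
    (SurfaceGroup.cutKernel d).map y.toMonoidHom = SurfaceGroup.cutKernel d := by
  refine SurfaceGroup.map_cutKernel_eq_of y d d (fun i => ?_) (fun i => ?_)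
  · by_cases hik : i = k
    · subst hik; exact hk
    by_cases hil : i = l
    · subst hil; exact hl
    rw [hfix i hik hil]
    exact SurfaceGroup.erase_of_cut d i
  · by_cases hik : i = k
    · subst hik; exact hk'
    by_cases hil : i = l
    · subst hil; exact hl'
    rw [symm_apply_of_eq y (hfix i hik hil _)]
    exact SurfaceGroup.erase_of_cut d i

/-- **Two-handle induced-map test.**  An automorphism `y` of `S_g` fixing the generators of all
handles other than `k`, `l` induces `θ` through `eraseA` (`eraseA ∘ y = θ ∘ eraseA`) as soon as
`θ` fixes the letters `xᵢ`, `i ∉ {k, l}`, `y a_k`, `y a_l` die under `eraseA` and `y b_k`,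
`y b_l` erase to `θ x_k`, `θ x_l`. [folklore] -/
theorem eraseA_apply_eq_of_block (y : SurfaceGroup g ≃* SurfaceGroup g)
    (θ : MulAut (FreeGroup (Fin g))) (k l : Fin g)
    (hfix : ∀ i, i ≠ k → i ≠ l → ∀ s, y (PresentedGroup.of (i, s)) = PresentedGroup.of (i, s))
    (hθ : ∀ i, i ≠ k → i ≠ l → θ (FreeGroup.of i) = FreeGroup.of i)
    (hak : SurfaceGroup.eraseA (y (SurfaceGroup.a k)) = 1)
    (hal : SurfaceGroup.eraseA (y (SurfaceGroup.a l)) = 1)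
    (hbk : SurfaceGroup.eraseA (y (SurfaceGroup.b k)) = θ (FreeGroup.of k))
    (hbl : SurfaceGroup.eraseA (y (SurfaceGroup.b l)) = θ (FreeGroup.of l)) :
    ∀ s, SurfaceGroup.eraseA (y s) = θ (SurfaceGroup.eraseA s) := by
  have key : (SurfaceGroup.eraseA (g := g)).comp y.toMonoidHom =
      θ.toMonoidHom.comp SurfaceGroup.eraseA :=
    PresentedGroup.ext fun p => by
      obtain ⟨i, s⟩ := p
      simp only [MonoidHom.comp_apply, MulEquiv.coe_toMonoidHom]
      by_cases hik : i = k
      · subst hik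
        cases s
        · rw [← SurfaceGroup.a_def, hak, SurfaceGroup.eraseA_a, map_one]
        · rw [← SurfaceGroup.b_def, hbk, SurfaceGroup.eraseA_b]
      by_cases hil : i = l
      · subst hil
        cases s
        · rw [← SurfaceGroup.a_def, hal, SurfaceGroup.eraseA_a, map_one]
        · rw [← SurfaceGroup.b_def, hbl, SurfaceGroup.eraseA_b]
      rw [hfix i hik hil]
      cases s
      · rw [← SurfaceGroup.a_def, SurfaceGroup.eraseA_a, map_one]
      · rw [← SurfaceGroup.b_def, SurfaceGroup.eraseA_b, hθ i hik hil]
  intro s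
  exact DFunLike.congr_fun key s

/-! ## §2 Transport to the standard kernels -/

/-- The cut pattern of slot `0` is the cut swap of slot `1` applied to the pattern
`dPat i = (i % 3 ≠ 0)` of the `a`-normalisation (case analysis on `i % 3`). [folklore] -/
theorem cPat_zero_eq (m : ℕ) :
    (fun i : Fin (3 + 3 * m) => if cPat m 1 i then !(decide ((i : ℕ) % 3 ≠ 0))
      else decide ((i : ℕ) % 3 ≠ 0)) = cPat m 0 := by
  funext i
  simp only [cPat, Fin.val_one, Fin.val_zero, add_zero]
  have h3 : (i : ℕ) % 3 < 3 := Nat.mod_lt _ (by norm_num)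
  by_cases h0 : (i : ℕ) % 3 = 0
  · have h1 : ((i : ℕ) + 1) % 3 ≠ 2 := by omega
    simp [h0, h1]
  by_cases h1 : (i : ℕ) % 3 = 1
  · have h2 : ((i : ℕ) + 1) % 3 = 2 := by omega
    simp [h1, h2]
  · have h2 : (i : ℕ) % 3 = 2 := by omega
    have h4 : ((i : ℕ) + 1) % 3 ≠ 2 := by omega
    simp [h2, h4]

/-- The cut swap of slot `1` carries the second cut kernel of the `a`-normalisation onto `N m 0`.
[folklore] -/
theorem map_cutKernel_dPat (m : ℕ) :
    (SurfaceGroup.cutKernel (fun i : Fin (3 + 3 * m) => decide ((i : ℕ) % 3 ≠ 0))).map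
      (SurfaceGroup.cutSwapEquiv (cPat m 1)).toMonoidHom = N m 0 := by
  rw [N_eq_cutKernel, ← cPat_zero_eq m]
  exact SurfaceGroup.map_cutKernel_cutSwapEquiv _ _

/-- The cut swap of slot `1` carries `⟪aᵢ⟫` onto `N m 1`. [folklore] -/
theorem map_aKernel_cPat (m : ℕ) :
    (SurfaceGroup.aKernel (3 + 3 * m)).map (SurfaceGroup.cutSwapEquiv (cPat m 1)).toMonoidHom =
      N m 1 := by
  rw [N_eq_cutKernel]
  exact SurfaceGroup.map_aKernel_cutSwapEquiv _

/-- **TRANSPORT (registered helper `helper_movesGoeritz_1`)**: an automorphism `y` of `S_{3+3m}`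
stabilising `⟪aᵢ⟫` and `cutKernel (i ↦ i % 3 ≠ 0)` and inducing `θ` through `eraseA` yields,
conjugated by the cut swap of slot `1`, a Goeritz element inducing `θ` through `eraseN1`:
`θ ∈ goeritzInduced m`. [folklore] -/
theorem helper_movesGoeritz_1 : ∀ (m : ℕ) (θ : MulAut (FreeGroup (Fin (3 + 3 * m)))) (y : S m ≃* S m), (Literature.Topology.FourManifolds.SurfaceGroup.aKernel (3 + 3 * m)).map y.toMonoidHom = Literature.Topology.FourManifolds.SurfaceGroup.aKernel (3 + 3 * m) → (Literature.Topology.FourManifolds.SurfaceGroup.cutKernel (fun i : Fin (3 + 3 * m) => decide ((i : ℕ) % 3 ≠ 0))).map y.toMonoidHom = Literature.Topology.FourManifolds.SurfaceGroup.cutKernel (fun i : Fin (3 + 3 * m) => decide ((i : ℕ) % 3 ≠ 0)) → (∀ s, Literature.Topology.FourManifolds.SurfaceGroup.eraseA (y s) = θ (Literature.Topology.FourManifolds.SurfaceGroup.eraseA s)) → θ ∈ goeritzInduced m := by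
  intro m θ y hA hD hE
  set C := SurfaceGroup.cutSwapEquiv (g := 3 + 3 * m) (cPat m 1) with hC
  refine ⟨(C.symm.trans y).trans C, ?_, ?_, fun s => ?_⟩
  · rw [trans_toMonoidHom, trans_toMonoidHom, ← Subgroup.map_map, ← Subgroup.map_map,
      SurfaceGroup.map_symm_toMonoidHom_of_eq C (map_cutKernel_dPat m), hD, map_cutKernel_dPat]
  · rw [trans_toMonoidHom, trans_toMonoidHom, ← Subgroup.map_map, ← Subgroup.map_map,
      SurfaceGroup.map_symm_toMonoidHom_of_eq C (map_aKernel_cPat m), hA, map_aKernel_cPat]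
  · rw [eraseN1_apply, eraseN1_apply, MulEquiv.trans_apply, MulEquiv.trans_apply, ← hC,
      MulEquiv.symm_apply_apply, hE]

end Summit.SmoothPoincare4.SmoothPoincare4.Theorems.NormalFormStablyTrivial.Luft

end
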